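import Summits.ResolutionOfSingularities.ResolutionOfSingularities.Theorems.FrobeniusClosingPatchingRelPerfectConeTiltFamilyLevelTwo
import Summits.ResolutionOfSingularities.ResolutionOfSingularities.Theorems.FrobeniusClosingPatchingRelPerfectConeAddCharts
import Summits.ResolutionOfSingularities.ResolutionOfSingularities.Theorems.FrobeniusClosingPatchingRelPerfectConeTiltFamily
import Summits.ResolutionOfSingularities.ResolutionOfSingularities.Theorems.FrobeniusClosingPatchingRelPerfectConeDepthTwo
import Summits.ResolutionOfSingularities.ResolutionOfSingularities.Theorems.FrobeniusClosingPatchingRelPerfectCoreRungConeMember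
import Literature.AlgebraicGeometry.Resolution.BlowupPointSubalgebra
import HarnessLib

/-!
# Crux `PatchingRelPerfect` (stmt-ResolutionOfSingularities-16161), chain w52 — ALL weight-two-
# permissible perturbations of the cone at depth two: `(x₀x₁ + x₂² + g) + 𝔪⁴ ∈ 𝒞`, `g ∈ (x₀,x₁,x₂)·𝔪²`

[OURS · L1 W5.2 · rung] The definitive statement of this seat's depth-two cone rungs (r2c `g = 0`,
r2c♯ `g = x₂x₃²`, tilt family `g = x₃μ`): for `S` regular local with regular system of parameters
`x₀, …, x₃` (every characteristic, every residue field), `q = x₀x₁ + x₂²`, `P = (x₀, x₁, x₂)` and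
EVERY `g ∈ P·𝔪²`, the member `I = (q + g) + 𝔪⁴` is in the companion class with the r2c companion
`(P + 𝔪²)(I + 𝔪²(P + 𝔪²)) · 𝔪 ⊇ 𝔪⁷` and the r2c tower.  Since `I` depends only on `g` modulo `𝔪⁴`
and `𝔪³ = P·𝔪² + (x₃³)`, this is the complete WEIGHT-TWO-PERMISSIBLE class of depth-two one-form
members over the cone (kernel sentence (iii), CHAIN.md §4: generically NON-GRADED); the
complementary direction `g ≡ λ x₃³`, `λ` a unit, is the contact-migration case (`ord_{z₀} K = 1`;
this seat's HAND-NOTE-nongraded-A2.md, FOUND by hand, certificate open).  PROVED: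

* `coneAdd_charts` (all four Rees charts), `companion_cone_add_sup_pow_four` (explicit companion),
  `coreRung_cone_add_sup_pow_four`, `coreRung_fourthPowersPlus_cone_add`,
  `coreRung_fourthPowersPlus_cone_add_of_ringKrullDim`, `coreRung_cone_add_sup_pow_four_of_ringKrullDim`,
  `atomDimFourBlowupAt_fourthPowersPlus_cone_add`.

BC5-type FORMAT evidence; nothing here is a statement of the manuscript under review.

## References

* The Stacks Project, Tags 080A, 080B, 0804, 07Z3, 0BIQ. [StacksProject]
* Q. Liu, *Algebraic Geometry and Arithmetic Curves*, OUP 2002, Thm. 8.1.19 (a). [Liu2002]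
* H. Matsumura, *Commutative Ring Theory*, CUP 1986, Thms. 14.2, 16.2, 16.3. [Matsumura1987]
-/

-- `Summit.<Summit>.<Sub>.Theorems` with `Sub = Summit` (single-conjunct summit, D-0017)
set_option linter.dupNamespace false

noncomputable section

open CategoryTheory CategoryTheory.Limits AlgebraicGeometry Literature.AlgebraicGeometry.Resolution
open IsLocalRing

namespace Summit.ResolutionOfSingularities.ResolutionOfSingularities.Theorems

namespace ConeRung

universe u


/-! ## Level one over a regular local base -/

section LevelOneRegular

variable {S : Type u} [CommRing S] [IsRegularLocalRing S] (x : Fin 4 → S)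
  (hx : Ideal.span (Set.range x) = IsLocalRing.maximalIdeal S)
  (hd : (IsLocalRing.maximalIdeal S).spanFinrank = 4) (g : S)
  (hg : g ∈ Ideal.span {x 0, x 1, x 2} * Ideal.span (Set.range x) ^ 2)

local notation3 "M" => Ideal.span (Set.range x)
local notation3 "I2t" => Ideal.span {x 0 * x 1 + x 2 ^ 2 + g} ⊔ Ideal.span (Set.range x) ^ 4
local notation3 "PP" => Ideal.span {x 0, x 1, x 2}
local notation3 "QQ2t" => (PP ⊔ M ^ 2) * (I2t ⊔ M ^ 2 * (PP ⊔ M ^ 2))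
/-- the vertex-chart family index `k ↦ castSucc k ≠ 3` -/
local notation3 "jJ3" =>
  (fun k : Fin 3 => (⟨Fin.castSucc k, castSucc_ne_three k⟩ : {j : Fin 4 // j ≠ 3}))

/-! ### The four charts of `Bl_𝔪`: `x₀, x₁, x₂` by the two-step tower for `(u, F + u m)`, the
vertex chart `x₃` by the abstract level two -/

include hx hd hg in
/-- **Every blow-up of every Rees chart `Spec B_i` along `(I Q) B_i` is regular, and `Q ⊇ 𝔪⁶`** — charts
`i = 0, 1, 2`: `(u, F + u m)` is a weakly regular pair with regular quotient, two-step Euclid tower;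
vertex chart `i = 3`: the abstract level two (`isRegular_of_isBlowup_LKm_mul_span`) with `A = B₃`,
`t = u`, `v_k = e_k` and the tilt `m ∈ (e₀, e₁, e₂)` of `exists_tilt`.
[cite: Liu2002, Thm. 8.1.19 (a)] [cite: StacksProject, Tag 080A] -/
theorem cone_add_charts_and_bound :
    (∀ (i : Fin 4) (Y : Scheme.{u}) (ρ : Y ⟶ Spec (.of (chartRing x i))),
      IsBlowup ρ (affineBlowup.idealSheaf ((I2t * QQ2t).map (chartBase x i))) → Scheme.IsRegular Y) ∧
    IsLocalRing.maximalIdeal S ^ 6 ≤ QQ2t := by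
  refine ⟨fun i Y ρ hρ => ?_, ?_⟩
  swap
  · rw [← hx, show (6 : ℕ) = 2 + (2 + 2) from rfl, pow_add, pow_add]
    exact Ideal.mul_mono le_sup_right ((Ideal.mul_mono le_rfl le_sup_right).trans le_sup_right)
  by_cases hi : i = 3
  · subst hi
    haveI : IsDomain S := isDomain_of_isRegularLocalRing S
    have hqr := isQuasiRegular_regularSystemOfParameters hd x hx
    haveI : IsRegularRing (chartRing x 3) := isRegularRing_chart x hx hd 3
    haveI := isRegularRing_residue x hx
    haveI := isDomain_residue x hx
    have hx3 : x 3 ≠ 0 := (isRsopPart_comp_of_rsop hd x hx id Function.injective_id).ne_zero 3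
    haveI : IsDomain (chartRing x 3) := isDomain_chartRing x 3 hx3
    haveI : IsRegularRing (chartRing x 3 ⧸ Ideal.span (Set.range
        (Fin.cons (chartBase x 3 (x 3)) (fun k : Fin 3 => chartGen x 3 (jJ3 k).1) :
          Fin 4 → chartRing x 3))) :=
      isRegularRing_quot_cons_chartGen x 3 jJ3 hqr
    haveI : IsDomain (chartRing x 3 ⧸ Ideal.span (Set.range
        (Fin.cons (chartBase x 3 (x 3)) (fun k : Fin 3 => chartGen x 3 (jJ3 k).1) :
          Fin 4 → chartRing x 3))) :=
      isDomain_quot_span_range_cc x hx hd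
    haveI : IsDomain (chartRing x 3 ⧸ Ideal.span {chartBase x 3 (x 3)}) :=
      isDomain_chartRing_quot_span x 3 hqr
    have hc : IsQuasiRegular (Fin.cons (chartBase x 3 (x 3))
        (fun k : Fin 3 => chartGen x 3 (jJ3 k).1) : Fin 4 → chartRing x 3) :=
      isQuasiRegular_cons_chartGen x 3 jJ3 hqr jJ3_injective
    have hv : ∀ k : Fin 3, chartGen x 3 (jJ3 k).1 ∉ Ideal.span {chartBase x 3 (x 3)} :=
      fun k => chartGen_notMem_span_u x hx hd 3 _ (castSucc_ne_three k)
    have hFt := F_notMem_span_u x hx hd 3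
    have hreg1 : ∀ (k : Fin 3) (P : Ideal (chartRing x 3 ⧸ Ideal.span {chartBase x 3 (x 3),
        chartGen x 3 0 * chartGen x 3 1 + chartGen x 3 2 ^ 2})) [P.IsPrime],
        Ideal.Quotient.mk _ (chartGen x 3 (Fin.castSucc k)) ∉ P →
          IsRegularLocalRing (Localization.AtPrime P) :=
      fun k P _ hP => isRegularLocalRing_quot_span_u_F_three x hx hd P k hP
    obtain ⟨m, hmP, hm⟩ := exists_tilt_of_mem x g 3 hg
    rw [map_chartBase_I2Qg x g 3 m hm] at hρ
    have hu5 : chartBase x 3 (x 3) ^ 5 ∈ nonZeroDivisors (chartRing x 3) :=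
      pow_mem (reesChartBase_mem_nonZeroDivisors (x 3)
        (Ideal.mem_span_range_self (f := x) (x := 3))) 5
    exact isRegular_of_isBlowup_span_singleton_mul_of_forall hu5 _
      (fun Y' ρ' h' => isRegular_of_isBlowup_LKm_mul_span (chartBase x 3 (x 3))
        (fun k : Fin 3 => chartGen x 3 (jJ3 k).1) m hc hv hFt hmP hreg1 h') hρ
  · haveI := isRegularRing_chart x hx hd i
    haveI := isDomain_residue x hx
    have hqr := isQuasiRegular_regularSystemOfParameters hd x hx
    haveI := isDomain_chartRing_quot_span x i hqr
    obtain ⟨m, -, hm⟩ := exists_tilt_of_mem x g i hg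
    set x' : Fin 2 → chartRing x i := Fin.cons (chartBase x i (x i))
      (fun _ : Fin 1 => chartGen x i 0 * chartGen x i 1 + chartGen x i 2 ^ 2 +
        chartBase x i (x i) * m) with hx'def
    have hx' : IsQuasiRegular x' :=
      isQuasiRegular_of_isWeaklyRegular _ (CoreRungTower.isWeaklyRegular_pair_of_notMem
        (reesChartBase_mem_nonZeroDivisors (x i) (Ideal.mem_span_range_self (f := x) (x := i)))
        (F_add_mul_notMem_span_u x hx hd i m))
    have hR' : IsRegularRing (chartRing x i ⧸ Ideal.span (Set.range x')) := by
      have h : Ideal.span (Set.range x') = Ideal.span {chartBase x i (x i),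
          chartGen x i 0 * chartGen x i 1 + chartGen x i 2 ^ 2} := by
        rw [hx'def, Fin.range_cons (chartBase x i (x i))
          (fun _ : Fin 1 => chartGen x i 0 * chartGen x i 1 + chartGen x i 2 ^ 2 +
            chartBase x i (x i) * m), Set.range_const]
        exact span_u_F_add_mul x i m
      rw [h]
      fin_cases i
      · exact isRegularRing_quot_span_u_F_zero x hx hd
      · exact isRegularRing_quot_span_u_F_one x hx hd
      · exact isRegularRing_quot_span_u_F_two x hx hd
      · exact absurd rfl hi
    have hu5 : chartBase x i (x i) ^ 5 ∈ nonZeroDivisors (chartRing x i) :=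
      pow_mem (reesChartBase_mem_nonZeroDivisors (x i)
        (Ideal.mem_span_range_self (f := x) (x := i))) 5
    rw [map_chartBase_I2Qg_of_ne_three x g i m hi hm, ← CoreRungTower.towerTwo_eq] at hρ
    exact CoreRungTower.isRegular_of_isBlowup_span_singleton_mul hu5 _
      (fun Y' ρ' h' => isRegular_of_isBlowup_tower 2 x' (fun _ : Fin 1 => (1 : Fin 2))
        (Function.injective_of_subsingleton _) hx' hR' h') hρ

include hx hd hg in
/-- **CORE RUNG — all weight-two-permissible perturbations of the cone at depth two.**  For `S`
regular local with regular system of parameters `x₀, …, x₃`, every `g ∈ (x₀, x₁, x₂)·𝔪²` and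
`I = (x₀x₁ + x₂² + g) + 𝔪⁴`, every blowing up `T = Bl_I Spec S` carries a non-zero ideal sheaf
cosupported in the closed fibre whose blowing up is regular.  Every characteristic, every residue
field. [cite: StacksProject, Tag 080A] [cite: Liu2002, Thm. 8.1.19 (a)] -/
theorem coreRung_cone_add_sup_pow_four (T : Scheme.{u}) (f : T ⟶ Spec (.of S))
    (hf : IsBlowup f (affineBlowup.idealSheaf
      (Ideal.span {x 0 * x 1 + x 2 ^ 2 + g} ⊔ IsLocalRing.maximalIdeal S ^ 4))) :
    ∃ (J : T.IdealSheafData) (T' : Scheme.{u}) (π : T' ⟶ T), J ≠ ⊥ ∧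
      (∀ t : T, t ∈ J.support → f.base t = IsLocalRing.closedPoint S) ∧
      IsBlowup π J ∧ Scheme.IsRegular T' := by
  haveI : IsDomain S := isDomain_of_isRegularLocalRing S
  have hx0 : x 0 ≠ 0 := (isRsopPart_comp_of_rsop hd x hx id Function.injective_id).ne_zero 0
  have h𝔪 : IsLocalRing.maximalIdeal S ≠ ⊥ := fun h => hx0 (by
    have := hx.le (Ideal.subset_span (Set.mem_range_self 0)); rw [h] at this
    exact (Submodule.mem_bot S).mp this)
  have hI : (I2t) ≠ ⊥ := fun h => pow_ne_zero 4 h𝔪 (by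
    rw [← hx]; exact eq_bot_iff.mpr (le_sup_right.trans h.le))
  have h := cone_add_charts_and_bound x hx hd g hg
  rw [← hx] at hf
  exact atomConclusion_of_pointBlowup_charts x hx h𝔪 hI h.2 h.1 T f hf

include hx hd hg in
/-- **The Frobenius-shaped variant `(x₀⁴, x₁⁴, x₂⁴, x₃⁴, x₀x₁ + x₂² + g)`** — a sup-reduction of
`(f) + 𝔪⁴` (`(xᵢ⁴) · 𝔪¹² = 𝔪¹⁶`). [cite: StacksProject, Tag 080A] [cite: Liu2002, Thm. 8.1.19 (a)] -/
theorem coreRung_fourthPowersPlus_cone_add (T : Scheme.{u}) (f : T ⟶ Spec (.of S))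
    (hf : IsBlowup f (affineBlowup.idealSheaf
      (Ideal.span (Set.range (fun i : Fin 4 => x i ^ 4) ∪ {x 0 * x 1 + x 2 ^ 2 + g})))) :
    ∃ (J : T.IdealSheafData) (T' : Scheme.{u}) (π : T' ⟶ T), J ≠ ⊥ ∧
      (∀ t : T, t ∈ J.support → f.base t = IsLocalRing.closedPoint S) ∧
      IsBlowup π J ∧ Scheme.IsRegular T' := by
  haveI : IsDomain S := isDomain_of_isRegularLocalRing S
  have hx0 : x 0 ≠ 0 := (isRsopPart_comp_of_rsop hd x hx id Function.injective_id).ne_zero 0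
  -- the pigeonhole `(xᵢ⁴) · 𝔪¹² = 𝔪¹⁶`
  have hred :
      Ideal.span (Set.range fun i : Fin 4 => x i ^ 4) * (M ^ 4) ^ 3 = (M ^ 4) ^ (3 + 1) := by
    rw [← pow_mul, ← pow_mul, CoreRung.span_powers_mul_pow_eq_pow x rfl (by norm_num)]
  have hle : Ideal.span (Set.range fun i : Fin 4 => x i ^ 4) ≤ M ^ 4 := by
    rw [Ideal.span_le]
    rintro _ ⟨i, rfl⟩
    exact Ideal.pow_mem_pow (Ideal.subset_span (Set.mem_range_self i)) 4
  have hI :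
      Ideal.span {x 0 * x 1 + x 2 ^ 2 + g} ⊔
        Ideal.span (Set.range fun i : Fin 4 => x i ^ 4) ≠ ⊥ :=
    fun h => pow_ne_zero 4 hx0 ((Submodule.eq_bot_iff _).mp h _
      (Ideal.mem_sup_right (Ideal.subset_span
        (Set.mem_range_self (f := fun i : Fin 4 => x i ^ 4) 0))))
  have hKm : IsLocalRing.maximalIdeal S ^ 4 ≤ I2t := by rw [← hx]; exact le_sup_right
  rw [Ideal.span_union, sup_comm] at hf
  have h := cone_add_charts_and_bound x hx hd g hg
  obtain ⟨Y, b, hb⟩ := exists_isBlowup (Spec (.of S)) (affineBlowup.idealSheaf ((I2t * QQ2t) * M))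
  have hY : Scheme.IsRegular Y := isRegular_of_isBlowup_mul_of_charts x (I2t * QQ2t) h.1 hb
  have h7 : IsLocalRing.maximalIdeal S ^ 7 ≤ QQ2t * M := by
    rw [pow_succ]
    exact Ideal.mul_mono h.2 hx.symm.le
  rw [mul_assoc] at hb
  exact coreRung_sup_reduction_of_companion hle hred hI hKm ⟨QQ2t * M, 7, h7, Y, b, hb, hY⟩ T f hf

end LevelOneRegular

/-- **The `TargetR2pt` binder shape** (plan-1's `ChainW52TargetsC.lean`): dimension given as
`ringKrullDim S = 4` with a generating family `x` of length `4`.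
[cite: StacksProject, Tag 080A] [cite: Liu2002, Thm. 8.1.19 (a)] -/
theorem coreRung_fourthPowersPlus_cone_add_of_ringKrullDim {S : Type u} [CommRing S]
    [IsRegularLocalRing S] (x : Fin 4 → S)
    (hx : Ideal.span (Set.range x) = IsLocalRing.maximalIdeal S)
    (hdim : ringKrullDim S = (4 : ℕ)) (g : S)
    (hg : g ∈ Ideal.span {x 0, x 1, x 2} * IsLocalRing.maximalIdeal S ^ 2)
    (T : Scheme.{u}) (f : T ⟶ Spec (.of S))
    (hf : IsBlowup f (affineBlowup.idealSheaf
      (Ideal.span (Set.range (fun i : Fin 4 => x i ^ 4) ∪ {x 0 * x 1 + x 2 ^ 2 + g})))) :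
    ∃ (J : T.IdealSheafData) (T' : Scheme.{u}) (π : T' ⟶ T), J ≠ ⊥ ∧
      (∀ t : T, t ∈ J.support → f.base t = IsLocalRing.closedPoint S) ∧
      IsBlowup π J ∧ Scheme.IsRegular T' := by
  have hd : (IsLocalRing.maximalIdeal S).spanFinrank = 4 := by
    have h := IsRegularLocalRing.spanFinrank_maximalIdeal (R := S)
    rw [hdim] at h
    exact_mod_cast h
  rw [← hx] at hg
  exact coreRung_fourthPowersPlus_cone_add x hx hd g hg T f hf

/-- **The same for `(f) + 𝔪⁴` in the `ringKrullDim` binder shape.** [cite: StacksProject, Tag 080A] -/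
theorem coreRung_cone_add_sup_pow_four_of_ringKrullDim {S : Type u} [CommRing S]
    [IsRegularLocalRing S] (x : Fin 4 → S)
    (hx : Ideal.span (Set.range x) = IsLocalRing.maximalIdeal S)
    (hdim : ringKrullDim S = (4 : ℕ)) (g : S)
    (hg : g ∈ Ideal.span {x 0, x 1, x 2} * IsLocalRing.maximalIdeal S ^ 2)
    (T : Scheme.{u}) (f : T ⟶ Spec (.of S))
    (hf : IsBlowup f (affineBlowup.idealSheaf
      (Ideal.span {x 0 * x 1 + x 2 ^ 2 + g} ⊔ IsLocalRing.maximalIdeal S ^ 4))) :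
    ∃ (J : T.IdealSheafData) (T' : Scheme.{u}) (π : T' ⟶ T), J ≠ ⊥ ∧
      (∀ t : T, t ∈ J.support → f.base t = IsLocalRing.closedPoint S) ∧
      IsBlowup π J ∧ Scheme.IsRegular T' := by
  have hd : (IsLocalRing.maximalIdeal S).spanFinrank = 4 := by
    have h := IsRegularLocalRing.spanFinrank_maximalIdeal (R := S)
    rw [hdim] at h
    exact_mod_cast h
  rw [← hx] at hg
  exact coreRung_cone_add_sup_pow_four x hx hd g hg T f hf

/-- **The registered core's binder shape, restricted to the member** (hypotheses of
`stub_atomDimFourBlowup`; characteristic, completeness, residue field and the off-fibre hypothesis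
unused). [cite: StacksProject, Tag 080A] [cite: Liu2002, Thm. 8.1.19 (a)] -/
theorem atomDimFourBlowupAt_fourthPowersPlus_cone_add (p : ℕ) (_hp : p.Prime) (S : Type)
    [CommRing S] [IsRegularLocalRing S] [CharP S p] [IsAdicComplete (IsLocalRing.maximalIdeal S) S]
    [PerfectField (IsLocalRing.ResidueField S)] (hS : ringKrullDim S = (4 : ℕ))
    (x : Fin 4 → S) (hx : Ideal.span (Set.range x) = IsLocalRing.maximalIdeal S) (g : S)
    (hg : g ∈ Ideal.span {x 0, x 1, x 2} * IsLocalRing.maximalIdeal S ^ 2)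
    (T : Scheme.{0}) (f : T ⟶ Spec (.of S))
    (hf : IsBlowup f (affineBlowup.idealSheaf
      (Ideal.span (Set.range (fun j : Fin 4 => x j ^ 4) ∪ {x 0 * x 1 + x 2 ^ 2 + g}))))
    (_hoff : ∀ t : T, f.base t ≠ IsLocalRing.closedPoint S →
      IsRegularLocalRing (T.presheaf.stalk t)) :
    ∃ (J : T.IdealSheafData) (T' : Scheme.{0}) (π : T' ⟶ T), J ≠ ⊥ ∧
      (∀ t : T, t ∈ J.support → f.base t = IsLocalRing.closedPoint S) ∧
      IsBlowup π J ∧ Scheme.IsRegular T' :=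
  coreRung_fourthPowersPlus_cone_add_of_ringKrullDim x hx hS g hg T f hf


/-! ## Appendix: the perturbation only matters modulo `𝔪⁴` -/

/-- `(a + r) + J = (a) + J` as ideals when `r ∈ J`. [folklore] -/
theorem span_singleton_add_sup_of_mem {A : Type*} [CommRing A] (a r : A) {J : Ideal A} (hr : r ∈ J) :
    Ideal.span {a + r} ⊔ J = Ideal.span {a} ⊔ J := by
  apply le_antisymm
  · refine sup_le ?_ le_sup_right
    rw [Ideal.span_singleton_le_iff_mem]
    exact Ideal.add_mem _ (Ideal.mem_sup_left (Ideal.subset_span rfl)) (Ideal.mem_sup_right hr)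
  · refine sup_le ?_ le_sup_right
    rw [Ideal.span_singleton_le_iff_mem]
    have h : (a + r) - r ∈ Ideal.span {a + r} ⊔ J :=
      Ideal.sub_mem _ (Ideal.mem_sup_left (Ideal.subset_span rfl)) (Ideal.mem_sup_right hr)
    rwa [add_sub_cancel_right] at h

/-- **The complete weight-two-permissible class modulo `𝔪⁴`**: for every `g ∈ (x₀, x₁, x₂)·𝔪² + 𝔪⁴`
(equivalently: `g ∈ 𝔪³` whose `x₃³`-coefficient lies in `𝔪`, since `𝔪³ = (x₀,x₁,x₂)·𝔪² + (x₃³)`), every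
blowing up of `Spec S` along `(x₀x₁ + x₂² + g) + 𝔪⁴` satisfies the blow-up-form core conclusion — the
ideal only depends on `g` modulo `𝔪⁴`. [cite: StacksProject, Tag 080A] [cite: Liu2002, Thm. 8.1.19 (a)] -/
theorem coreRung_cone_add_sup_pow_four_of_mem_sup {S : Type u} [CommRing S]
    [IsRegularLocalRing S] (x : Fin 4 → S)
    (hx : Ideal.span (Set.range x) = IsLocalRing.maximalIdeal S)
    (hdim : ringKrullDim S = (4 : ℕ)) (g : S)
    (hg : g ∈ Ideal.span {x 0, x 1, x 2} * IsLocalRing.maximalIdeal S ^ 2 ⊔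
      IsLocalRing.maximalIdeal S ^ 4)
    (T : Scheme.{u}) (f : T ⟶ Spec (.of S))
    (hf : IsBlowup f (affineBlowup.idealSheaf
      (Ideal.span {x 0 * x 1 + x 2 ^ 2 + g} ⊔ IsLocalRing.maximalIdeal S ^ 4))) :
    ∃ (J : T.IdealSheafData) (T' : Scheme.{u}) (π : T' ⟶ T), J ≠ ⊥ ∧
      (∀ t : T, t ∈ J.support → f.base t = IsLocalRing.closedPoint S) ∧
      IsBlowup π J ∧ Scheme.IsRegular T' := by
  obtain ⟨g', hg', r, hr, hgr⟩ := Submodule.mem_sup.mp hg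
  rw [← hgr, ← add_assoc, span_singleton_add_sup_of_mem _ _ hr] at hf
  exact coreRung_cone_add_sup_pow_four_of_ringKrullDim x hx hdim g' hg' T f hf

end ConeRung

end Summit.ResolutionOfSingularities.ResolutionOfSingularities.Theorems

end
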